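import Literature.NumberTheory.Automorphic.SatakeTransformGLIwasawaDatum
import Literature.NumberTheory.Automorphic.SatakeTransformIwasawaInjective
import Literature.NumberTheory.Automorphic.CartanIwasawaDominanceGL
import Literature.NumberTheory.Automorphic.CartanDecompositionGLnPowers
import Literature.NumberTheory.Automorphic.HyperspecialUnitarySatakeInjective
import HarnessLib

/-!
# The Satake transform of `ℋ(GL_n(F), GL_n(𝒪))` is injective over any discretely valued field with finite residue field,
# and the spherical Hecke algebra is therefore commutative (Cartier 1979, Thm. 4.1, injectivity half, for `GL_n`)

Topic `NumberTheory/Automorphic`; namespace `Literature.NumberTheory.Automorphic` (lane `lit-hodgefound`, Track 2 foundations;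
seat `lit-hodgefound-p11`, generation 37, row g37-#15).  THEOREMS ONLY: no definition, no named fact, no instance, no notation.
Assembles the bridge `SatakeTransformGLIwasawaDatum` (`satakeTransform hϖ = (isIwasawaExponent_gl hϖ).satakeTransform w`), the
abstract criterion `SatakeTransformIwasawaInjective`, the tree's `CartanDecompositionGLnPowers` (`k₁ g k₂ = ϖ^a`, `a` antitone)
and `CartanIwasawaDominanceGL` (Bruhat–Tits (4.4.4) (i) for `GL_n`), with the head-sum refinement of
`HyperspecialUnitarySatakeInjective` §1.

The tree's Satake ISOMORPHISM for `GL_n` (`SatakeGL.satakeAlgEquiv`, `SatakeParametersGLIsoProofs`) is proved under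
`[IsMulCommutative ℋ]` (supplied for non-archimedean LOCAL fields by Gelfand's trick, `isGelfandPair_glInt_holds`); the
injectivity below needs neither commutativity nor completeness nor a Hecke-triple instance, and YIELDS the commutativity of
`ℋ(GL_n(F), GL_n(𝒪)) ⊗ ℂ` for every field `F` with a `ValuativeRel` whose valuation ring is a DVR with finite residue field
(Satake's route to commutativity, [CartierCorvallis1979] §IV Thm. 4.1 Cor.).

## The print

[CartierCorvallis1979] §IV Thm. 4.1 and proof (b)–(c); [Macdonald1995] Ch. V (2.6)–(2.7), (3.3)–(3.4): for `GL_n(F)` the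
`Sc_λ` are triangular in the dominance order with non-zero leading term, hence `S` is injective; Cor.: `ℋ(G, K)` is
commutative.  [BruhatTits1972] Prop. (4.4.4) (i).

## What is formalised (`F` a field with `ValuativeRel F`, `𝒪[F]` a DVR, `ϖ` uniformizing; `Finite 𝓀[F]` from §2 on)

* §1 `iwasawaExp_zpowDiagGL_gl` (`e(ϖ^a) = a`), `exists_zpowDiagGL_mem_orbit` (CARTAN: `D = {ϖ^a : a antitone}`),
  `injOn_iwasawaExp_zpowDiagGL` (SEPARATION), **`iwasawaExp_eq_or_headSum_lt`** (DOMINANCE, from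
  `sum_iwasawaExp_head_le_of_mem_orbit`).
* §2 **`isIwasawaExponent_gl_satakeTransform_injective`** (every weight, every coefficient domain of characteristic `0`),
  **`glSatakeTransform_injective`** — `satakeTransform hϖ : ℋ(GL_n(F), GL_n(𝒪)) →ₐ[ℂ] ℂ[ℤⁿ]` IS INJECTIVE.
* §3 **`isMulCommutative_heckeAlgebra_gl`** — `ℋ(GL_n(F), GL_n(𝒪))` (over `ℂ`) is commutative; `heckeAlgebra_gl_mul_comm`.

## References
* [CartierCorvallis1979] P. Cartier, *Representations of 𝔭-adic groups: a survey*, PSPM 33.1 (1979), §IV Thm. 4.1, proof and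
  Cor.
* [Macdonald1995] I. G. Macdonald, *Symmetric Functions and Hall Polynomials*, 2nd ed. (1995), Ch. V (2.6)–(2.7), (3.3)–(3.4).
* [BruhatTits1972] F. Bruhat, J. Tits, Publ. Math. IHÉS 41 (1972), Prop. (4.4.4).
-/

noncomputable section

open scoped MatrixGroups
open ValuativeRel Matrix Finset MonoidAlgebra Representation

namespace Literature.NumberTheory.Automorphic

open Literature.NumberTheory.Automorphic.HermitianLattice

variable {F : Type*} [Field F] [ValuativeRel F] {n : ℕ} [IsDiscreteValuationRing 𝒪[F]] {ϖ : F}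

/-! ## §1 (CARTAN), (SEPARATION), (DOMINANCE) for `GL_n` -/

/-- `e(ϖ^a) = a`. [cite: CartierCorvallis1979, §IV (4.2)] -/
theorem iwasawaExp_zpowDiagGL_gl (hϖ : IsUniformizingElement ϖ) (a : Fin n → ℤ) :
    iwasawaExp hϖ (zpowDiagGL hϖ.ne_zero a) = a :=
  iwasawaExp_eq hϖ (upperUnitriangular (Fin n) F).one_mem (glInt n F).one_mem (by rw [one_mul, mul_one])

/-- **(CARTAN)**: every coset `γ₀ ∈ GL_n(F)/GL_n(𝒪)` has some `ϖ^a GL_n(𝒪)`, `a` antitone, in its `GL_n(𝒪)`-orbit.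
[cite: CartierCorvallis1979, §IV (4.2) (Cartan decomposition for `GL_n`)] -/
theorem exists_zpowDiagGL_mem_orbit (hϖ : IsUniformizingElement ϖ) (γ₀ : GL (Fin n) F ⧸ glInt n F) :
    ∃ t ∈ {t : GL (Fin n) F | ∃ a : Fin n → ℤ, Antitone a ∧ t = zpowDiagGL hϖ.ne_zero a},
      (t : GL (Fin n) F ⧸ glInt n F) ∈ MulAction.orbit (glInt n F) γ₀ := by
  obtain ⟨k₁, hk₁, k₂, hk₂, a, ha, h⟩ := exists_glInt_mul_mul_eq_zpowDiagGL hϖ γ₀.out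
  refine ⟨_, ⟨a, ha, rfl⟩, ?_⟩
  rw [← QuotientGroup.out_eq' γ₀, heckeAlgebra.coe_mem_orbit_coe_iff]
  exact ⟨k₁, hk₁, k₂, hk₂, h.symm⟩

/-- **(SEPARATION)**: `ϖ^a ↦ e(ϖ^a) = a` is injective on the Cartan representatives. [cite: CartierCorvallis1979, §IV (4.2)] -/
theorem injOn_iwasawaExp_zpowDiagGL (hϖ : IsUniformizingElement ϖ) :
    Set.InjOn (iwasawaExp hϖ) {t : GL (Fin n) F | ∃ a : Fin n → ℤ, Antitone a ∧ t = zpowDiagGL hϖ.ne_zero a} := by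
  rintro _ ⟨a, -, rfl⟩ _ ⟨a', -, rfl⟩ h
  rw [iwasawaExp_zpowDiagGL_gl, iwasawaExp_zpowDiagGL_gl] at h
  rw [h]

/-- **(DOMINANCE)** — Bruhat–Tits (4.4.4) (i) for `GL_n` in the form used by the abstract criterion: for a coset
`γ ⊆ K ϖ^a K` (`a` antitone) either `e(γ) = a` or the head-sum vector of `e(γ)` is lexicographically SMALLER than that of
`a`. [cite: BruhatTits1972, Prop. (4.4.4) (i)] [cite: Macdonald1995, Ch. V (2.6)] -/
theorem iwasawaExp_eq_or_headSum_lt (hϖ : IsUniformizingElement ϖ) :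
    ∀ t ∈ {t : GL (Fin n) F | ∃ a : Fin n → ℤ, Antitone a ∧ t = zpowDiagGL hϖ.ne_zero a},
      ∀ γ ∈ MulAction.orbit (glInt n F) (t : GL (Fin n) F ⧸ glInt n F),
        iwasawaExp hϖ γ.out = iwasawaExp hϖ t ∨
          toLex (fun r : Fin n => ∑ i : Fin n, if (i : ℕ) < (r : ℕ) + 1 then iwasawaExp hϖ γ.out i else 0) <
            toLex (fun r : Fin n => ∑ i : Fin n, if (i : ℕ) < (r : ℕ) + 1 then iwasawaExp hϖ t i else 0) := by
  rintro _ ⟨a, ha, rfl⟩ γ hγ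
  rw [iwasawaExp_zpowDiagGL_gl]
  have hγ' : (γ.out : GL (Fin n) F ⧸ glInt n F) ∈ MulAction.orbit (glInt n F) (zpowDiagGL hϖ.ne_zero a : GL (Fin n) F ⧸ glInt n F) := by
    rwa [QuotientGroup.out_eq']
  have hle : ∀ r : ℕ, (∑ i : Fin n, if (i : ℕ) < r then iwasawaExp hϖ γ.out i else 0) ≤
      ∑ i : Fin n, if (i : ℕ) < r then a i else 0 := fun r => sum_iwasawaExp_head_le_of_mem_orbit hϖ ha hγ' r
  rcases (toLex_headSum_le_of_forall_le hle).lt_or_eq with hlt | heq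
  · exact Or.inr hlt
  · exact Or.inl (eq_of_forall_le_of_toLex_le hle heq.ge)

/-! ## §2 Injectivity -/

/-- **Injectivity for every weight**: the abstract Satake transform of the `GL_n` Iwasawa datum is injective over every
domain of characteristic `0`, for every weight `w`. [cite: CartierCorvallis1979, §IV Thm. 4.1] [cite: BruhatTits1972, Prop. (4.4.4) (i)] -/
theorem isIwasawaExponent_gl_satakeTransform_injective {R : Type*} [CommRing R] [IsDomain R] [CharZero R]
    (hϖ : IsUniformizingElement ϖ) (w : Multiplicative (Fin n → ℤ) →* R) :
    Function.Injective ((isIwasawaExponent_gl hϖ).satakeTransform w) :=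
  (isIwasawaExponent_gl hϖ).satakeTransform_injective w
    (φ := fun μ : Fin n → ℤ => toLex (fun r : Fin n => ∑ i : Fin n, if (i : ℕ) < (r : ℕ) + 1 then μ i else 0))
    (exists_zpowDiagGL_mem_orbit hϖ) (injOn_iwasawaExp_zpowDiagGL hϖ) (iwasawaExp_eq_or_headSum_lt hϖ)

variable [Finite 𝓀[F]]

/-- **THE SATAKE TRANSFORM OF `ℋ(GL_n(F), GL_n(𝒪))` IS INJECTIVE** for every field `F` with a `ValuativeRel` whose valuation
ring is a DVR with finite residue field (no completeness, no commutativity hypothesis). [cite: CartierCorvallis1979, §IV Thm. 4.1]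
[cite: Macdonald1995, Ch. V (3.3)–(3.4)] -/
theorem glSatakeTransform_injective (hϖ : IsUniformizingElement ϖ) : Function.Injective (satakeTransform (n := n) hϖ) := by
  rw [satakeTransform_eq_isIwasawaExponent_satakeTransform]
  exact isIwasawaExponent_gl_satakeTransform_injective hϖ _

/-! ## §3 Commutativity of the spherical Hecke algebra of `GL_n` via Satake -/

/-- **`ℋ(GL_n(F), GL_n(𝒪))` is commutative** (over `ℂ`): the Satake transform is an injective algebra homomorphism into the
commutative algebra `ℂ[ℤⁿ]`. [cite: CartierCorvallis1979, §IV Thm. 4.1, Cor.] -/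
theorem heckeAlgebra_gl_mul_comm (hϖ : IsUniformizingElement ϖ) (S T : heckeAlgebra ℂ (GL (Fin n) F) (glInt n F)) :
    S * T = T * S :=
  glSatakeTransform_injective hϖ (by rw [map_mul, map_mul, mul_comm])

omit [IsDiscreteValuationRing 𝒪[F]] [Finite 𝓀[F]] in
/-- **`ℋ(GL_n(F), GL_n(𝒪))` is commutative** as an `IsMulCommutative` statement, for any field whose valuation ring is a DVR
with finite residue field (a uniformiser exists). [cite: CartierCorvallis1979, §IV Thm. 4.1, Cor.] -/
theorem isMulCommutative_heckeAlgebra_gl [IsDiscreteValuationRing 𝒪[F]] [Finite 𝓀[F]] :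
    IsMulCommutative (heckeAlgebra ℂ (GL (Fin n) F) (glInt n F)) := by
  obtain ⟨ϖ, hϖ⟩ := exists_isUniformizingElement (F := F)
  exact ⟨⟨fun S T => heckeAlgebra_gl_mul_comm hϖ S T⟩⟩

end Literature.NumberTheory.Automorphic

end
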